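import Mathlib.Analysis.SpecialFunctions.Complex.Log
import Mathlib.Analysis.SpecialFunctions.Complex.Arg
import Mathlib.Analysis.SpecialFunctions.Complex.LogDeriv
import Mathlib.Analysis.SpecialFunctions.Trigonometric.Basic
import Summits.CriticalPhenomena.CardyFormulaZ2.Theses.CardyQContinuation

/-!
# Crux `IsingJetsConformal`, stub `stub_loopSymmetricLimit_discArcHarmonic`:
# the harmonic measure of an open arc of the unit circle as the real part of a holomorphic function
# (route `CardyQContinuation`, item stmt-CriticalPhenomena-5560)

For `a < b < a + 2π` let `J = {e^{iθ} : a < θ < b}` be an open arc of the unit circle. We produce an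
explicit holomorphic `F` on the unit disc with `0 < Re F < 1` inside, `Re F → 1` at every point of
`J` and `Re F → 0` at every point of the complementary open arc `{e^{iθ} : b < θ < a + 2π}`.

Construction. Put `c = (b - a)/2 ∈ (0, π)`, `m = (a + b)/2`, `u = e^{ic}`, rotate `z = e^{-im} w`,
and let `M = (z - u)/(u z - 1)` (a Möbius automorphism of the disc sending `e^{-ic} ↦ ∞`,
`e^{ic} ↦ 0`), `N = -i M`, `F = 1/2 - i log(N)/π`, so that `Re F = arg(N)/π + 1/2`. The identity
`(z - u) · conj(u z - 1) = conj(u) |z|² + u - 2 Re z` (for `|u| = 1`) gives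
`Im M = sin c · (1 - |z|²)/|u z - 1|²` and `Re M = (cos c · (1 + |z|²) - 2 Re z)/|u z - 1|²`.
Hence `Re N = Im M > 0` inside the disc (so `N` stays in the slit plane, `log N` is holomorphic
and `|arg N| < π/2`), while on the circle `z = e^{iφ}`, `φ = θ - m`, the number `M` is real with
the sign of `cos c - cos φ = -2 sin((c+φ)/2) sin((c-φ)/2)`: negative for `|φ| < c` (the arc,
`arg N = π/2`, `Re F = 1`) and positive for `c < φ < 2π - c` (the complementary arc,
`arg N = -π/2`, `Re F = 0`). At those boundary points the denominator does not vanish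
(`u z = e^{i(θ - a)} ≠ 1` as `0 < θ - a < 2π`) and `N` lies in the slit plane, so `F` is even
holomorphic there and `Re F` is continuous, which gives the two limits.

References: T. Ransford, *Potential theory in the complex plane* (1995), §4.3 (harmonic measure
of arcs of the disc); the computation is classical and carries no further source.
No sorry, no named fact; Mathlib only.
-/

namespace Summit.CriticalPhenomena.CardyFormulaZ2.Theorems.CardyQContinuation

open Complex Filter Metric Topology
open scoped Real

namespace DiscArcHarmonic

/-! ### Algebra of the Möbius map `z ↦ (z - u)/(u z - 1)` -/

/-- Imaginary part of the Möbius map `z ↦ (z - u)/(u z - 1)` for a unit `u`: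
`Im = Im u · (1 - |z|²)/|u z - 1|²`. [folklore] -/
theorem mob_im (u z : ℂ) (hu : normSq u = 1) :
    ((z - u) / (u * z - 1)).im = u.im * (1 - normSq z) / normSq (u * z - 1) := by
  rw [div_im, div_sub_div_same]
  congr 1
  rw [normSq_apply] at hu
  simp only [sub_re, sub_im, mul_re, mul_im, one_re, one_im, normSq_apply]
  linear_combination z.im * hu

/-- Real part of the Möbius map `z ↦ (z - u)/(u z - 1)` for a unit `u`:
`Re = (Re u · (1 + |z|²) - 2 Re z)/|u z - 1|²`. [folklore] -/
theorem mob_re (u z : ℂ) (hu : normSq u = 1) :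
    ((z - u) / (u * z - 1)).re = (u.re * (1 + normSq z) - 2 * z.re) / normSq (u * z - 1) := by
  rw [div_re, ← add_div]
  congr 1
  rw [normSq_apply] at hu
  simp only [sub_re, sub_im, mul_re, mul_im, one_re, one_im, normSq_apply]
  linear_combination (-z.re) * hu

/-- The denominator `u z - 1` does not vanish for `‖u‖ = 1` and `‖z‖ < 1`. [folklore] -/
theorem den_ne_zero (u z : ℂ) (hu : ‖u‖ = 1) (hz : ‖z‖ < 1) : u * z - 1 ≠ 0 := by
  intro h
  have h1 : ‖u * z‖ = 1 := by rw [sub_eq_zero.mp h, norm_one]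
  rw [norm_mul, hu, one_mul] at h1
  linarith

/-- Real part of the explicit function: `Re (1/2 - i log Z / π) = arg Z / π + 1/2`. [folklore] -/
theorem re_formula (Z : ℂ) : ((1 / 2 : ℂ) - I * log Z / (π : ℂ)).re = arg Z / π + 1 / 2 := by
  simp only [sub_re, div_ofNat_re, one_re, div_ofReal_re, mul_re, I_re, I_im, log_im, zero_mul,
    one_mul, zero_sub, neg_div]
  ring

/-- Inside the disc, `N = -i M` has positive real part (`‖u‖ = 1`, `Im u > 0`, `‖z‖ < 1`).
[folklore] -/
theorem N_re_pos (u z : ℂ) (hu : ‖u‖ = 1) (hui : 0 < u.im) (hz : ‖z‖ < 1) :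
    0 < (-I * ((z - u) / (u * z - 1))).re := by
  have hu' : normSq u = 1 := by rw [normSq_eq_norm_sq, hu, one_pow]
  rw [show ∀ M : ℂ, (-I * M).re = M.im from fun M => by simp, mob_im u z hu']
  have hD : 0 < normSq (u * z - 1) := normSq_pos.mpr (den_ne_zero u z hu hz)
  have hz2 : normSq z < 1 := by
    rw [normSq_eq_norm_sq]
    nlinarith [norm_nonneg z]
  exact div_pos (mul_pos hui (by linarith)) hD

/-! ### Calculus: the explicit function is holomorphic off the pole and the cut -/

/-- The explicit function `w ↦ 1/2 - i log(-i (v w - u)/(u v w - 1))/π` is complex differentiable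
at every `w` where the denominator is nonzero and `-i (v w - u)/(u v w - 1)` lies in the slit
plane. [folklore] -/
theorem differentiableAt_F (u v : ℂ) {w : ℂ} (hden : u * (v * w) - 1 ≠ 0)
    (hslit : -I * ((v * w - u) / (u * (v * w) - 1)) ∈ slitPlane) :
    DifferentiableAt ℂ
      (fun w : ℂ => (1 / 2 : ℂ) - I * log (-I * ((v * w - u) / (u * (v * w) - 1))) / (π : ℂ))
      w := by
  have hN : DifferentiableAt ℂ (fun w : ℂ => -I * ((v * w - u) / (u * (v * w) - 1))) w := by
    fun_prop (disch := exact hden)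
  exact (((hN.clog hslit).const_mul I).div_const (π : ℂ)).const_sub _

/-- Continuity of the real part of the explicit function at a regular point, along any set.
[folklore] -/
theorem tendsto_F_re (u v w₀ : ℂ) (s : Set ℂ) (hden : u * (v * w₀) - 1 ≠ 0)
    (hslit : -I * ((v * w₀ - u) / (u * (v * w₀) - 1)) ∈ slitPlane) :
    Tendsto
      (fun w : ℂ => ((1 / 2 : ℂ) - I * log (-I * ((v * w - u) / (u * (v * w) - 1))) / (π : ℂ)).re)
      (𝓝[s] w₀)
      (𝓝 (((1 / 2 : ℂ) - I * log (-I * ((v * w₀ - u) / (u * (v * w₀) - 1))) / (π : ℂ)).re)) :=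
  ((continuous_re.tendsto _).comp (differentiableAt_F u v hden hslit).continuousAt).mono_left
    nhdsWithin_le_nhds

/-! ### Trigonometry on the unit circle -/

/-- `e^{ix} e^{iy} = e^{i(x+y)}`. [folklore] -/
theorem exp_mul_I_mul_exp_mul_I (x y : ℝ) :
    exp ((x : ℂ) * I) * exp ((y : ℂ) * I) = exp (((x + y : ℝ) : ℂ) * I) := by
  rw [← Complex.exp_add]
  congr 1
  push_cast
  ring

/-- `|e^{ix}|² = 1`. [folklore] -/
theorem normSq_exp_mul_I (x : ℝ) : normSq (exp ((x : ℂ) * I)) = 1 := by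
  rw [normSq_eq_norm_sq, norm_exp_ofReal_mul_I, one_pow]

/-- `e^{ic} e^{iφ} ≠ 1` when `0 < c + φ < 2π`. [folklore] -/
theorem den_ne_zero_boundary (c φ : ℝ) (h0 : 0 < c + φ) (h2 : c + φ < 2 * π) :
    exp ((c : ℂ) * I) * exp ((φ : ℂ) * I) - 1 ≠ 0 := by
  rw [exp_mul_I_mul_exp_mul_I, sub_ne_zero]
  intro h
  have hre := congrArg re h
  rw [exp_ofReal_mul_I_re, one_re] at hre
  have := (Real.cos_eq_one_iff_of_lt_of_lt (by linarith) h2).mp hre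
  linarith

/-- `cos c - cos φ < 0` for `|φ| < c < π`. [folklore] -/
theorem cos_sub_cos_neg (c φ : ℝ) (hcπ : c < π) (h1 : -c < φ) (h2 : φ < c) :
    Real.cos c - Real.cos φ < 0 := by
  rw [Real.cos_sub_cos]
  have ha : 0 < Real.sin ((c + φ) / 2) := Real.sin_pos_of_pos_of_lt_pi (by linarith) (by linarith)
  have hb : 0 < Real.sin ((c - φ) / 2) := Real.sin_pos_of_pos_of_lt_pi (by linarith) (by linarith)
  nlinarith [mul_pos ha hb]

/-- `0 < cos c - cos φ` for `0 < c < φ < 2π - c`. [folklore] -/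
theorem cos_sub_cos_pos (c φ : ℝ) (hc0 : 0 < c) (h1 : c < φ) (h2 : φ < 2 * π - c) :
    0 < Real.cos c - Real.cos φ := by
  rw [Real.cos_sub_cos]
  have ha : 0 < Real.sin ((c + φ) / 2) := Real.sin_pos_of_pos_of_lt_pi (by linarith) (by linarith)
  have hb : Real.sin ((c - φ) / 2) < 0 :=
    Real.sin_neg_of_neg_of_neg_pi_lt (by linarith) (by linarith)
  nlinarith [mul_neg_of_pos_of_neg ha hb]

/-- Boundary values of `N = -i M` at `w₀ = e^{iθ}` (`z = e^{-im} e^{iθ}`, `u = e^{ic}`): when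
`0 < c + (θ - m) < 2π` the denominator is nonzero, `Re N = 0`, and
`Im N = -2 (cos c - cos (θ - m)) / |u z - 1|²`. [folklore] -/
theorem N_boundary (c m θ : ℝ) (h0 : 0 < c + (θ - m)) (h2 : c + (θ - m) < 2 * π) :
    exp ((c : ℂ) * I) * (exp (((-m : ℝ) : ℂ) * I) * exp ((θ : ℂ) * I)) - 1 ≠ 0 ∧
    (-I * ((exp (((-m : ℝ) : ℂ) * I) * exp ((θ : ℂ) * I) - exp ((c : ℂ) * I)) /
      (exp ((c : ℂ) * I) * (exp (((-m : ℝ) : ℂ) * I) * exp ((θ : ℂ) * I)) - 1))).re = 0 ∧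
    (-I * ((exp (((-m : ℝ) : ℂ) * I) * exp ((θ : ℂ) * I) - exp ((c : ℂ) * I)) /
      (exp ((c : ℂ) * I) * (exp (((-m : ℝ) : ℂ) * I) * exp ((θ : ℂ) * I)) - 1))).im =
      -(2 * (Real.cos c - Real.cos (-m + θ))) /
        normSq (exp ((c : ℂ) * I) * (exp (((-m : ℝ) : ℂ) * I) * exp ((θ : ℂ) * I)) - 1) := by
  rw [exp_mul_I_mul_exp_mul_I, show ∀ M : ℂ, (-I * M).re = M.im from fun M => by simp,
    show ∀ M : ℂ, (-I * M).im = -M.re from fun M => by simp, mob_im _ _ (normSq_exp_mul_I c),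
    mob_re _ _ (normSq_exp_mul_I c), normSq_exp_mul_I, exp_ofReal_mul_I_re, exp_ofReal_mul_I_re]
  refine ⟨den_ne_zero_boundary c (-m + θ) (by linarith) (by linarith), by simp, ?_⟩
  ring

end DiscArcHarmonic

open DiscArcHarmonic in
/-- **stub_loopSymmetricLimit_discArcHarmonic** (harmonic measure of an arc of the disc, explicit
form). For `a < b < a + 2π` there is a holomorphic `F` on the unit disc with `0 < Re F < 1`, whose
real part tends to `1` at every point `e^{iθ}`, `a < θ < b`, of the open arc and to `0` at every
point `e^{iθ}`, `b < θ < a + 2π`, of the complementary open arc. The witness is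
`F(w) = 1/2 - (i/π) log(-i (e^{-im} w - e^{ic})/(e^{ic} e^{-im} w - 1))`, `c = (b-a)/2`,
`m = (a+b)/2`. [folklore] -/
theorem stub_loopSymmetricLimit_discArcHarmonic : (∀ (a b : ℝ), a < b → b < a + 2 * Real.pi → ∃ F : ℂ → ℂ, DifferentiableOn ℂ F (Metric.ball 0 1) ∧ (∀ w ∈ Metric.ball (0 : ℂ) 1, 0 < (F w).re ∧ (F w).re < 1) ∧ (∀ θ : ℝ, a < θ → θ < b → Filter.Tendsto (fun w ↦ (F w).re) (nhdsWithin (Complex.exp (θ * Complex.I)) (Metric.ball 0 1)) (nhds 1)) ∧ (∀ θ : ℝ, b < θ → θ < a + 2 * Real.pi → Filter.Tendsto (fun w ↦ (F w).re) (nhdsWithin (Complex.exp (θ * Complex.I)) (Metric.ball 0 1)) (nhds 0))) := by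
  intro a b hab hba
  obtain ⟨c, hc⟩ : ∃ c : ℝ, c = (b - a) / 2 := ⟨_, rfl⟩
  obtain ⟨m, hm⟩ : ∃ m : ℝ, m = (a + b) / 2 := ⟨_, rfl⟩
  have hc0 : 0 < c := by rw [hc]; linarith
  have hcπ : c < π := by rw [hc]; linarith
  have hπ : 0 < π := Real.pi_pos
  have hun : ‖exp ((c : ℂ) * I)‖ = 1 := norm_exp_ofReal_mul_I c
  have hvn : ‖exp (((-m : ℝ) : ℂ) * I)‖ = 1 := norm_exp_ofReal_mul_I (-m)
  have hui : 0 < (exp ((c : ℂ) * I)).im := by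
    rw [exp_ofReal_mul_I_im]; exact Real.sin_pos_of_pos_of_lt_pi hc0 hcπ
  have hz : ∀ w ∈ ball (0 : ℂ) 1, ‖exp (((-m : ℝ) : ℂ) * I) * w‖ < 1 := fun w hw => by
    rwa [norm_mul, hvn, one_mul, ← mem_ball_zero_iff]
  refine ⟨fun w : ℂ => (1 / 2 : ℂ) - I * log (-I * ((exp (((-m : ℝ) : ℂ) * I) * w -
    exp ((c : ℂ) * I)) / (exp ((c : ℂ) * I) * (exp (((-m : ℝ) : ℂ) * I) * w) - 1))) / (π : ℂ),
    ?_, ?_, ?_, ?_⟩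
  · -- holomorphy inside the disc
    intro w hw
    exact (differentiableAt_F _ _ (den_ne_zero _ _ hun (hz w hw))
      (mem_slitPlane_iff.mpr (Or.inl (N_re_pos _ _ hun hui (hz w hw))))).differentiableWithinAt
  · -- `0 < Re F < 1` inside the disc
    intro w hw
    have harg := abs_arg_lt_pi_div_two_iff.mpr (Or.inl (N_re_pos _ _ hun hui (hz w hw)))
    rw [abs_lt] at harg
    rw [re_formula]
    constructor
    · have h1 : -(1 / 2) < arg (-I * ((exp (((-m : ℝ) : ℂ) * I) * w - exp ((c : ℂ) * I)) /
          (exp ((c : ℂ) * I) * (exp (((-m : ℝ) : ℂ) * I) * w) - 1))) / π := by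
        rw [lt_div_iff₀ hπ]; linarith [harg.1]
      linarith
    · have h2 : arg (-I * ((exp (((-m : ℝ) : ℂ) * I) * w - exp ((c : ℂ) * I)) /
          (exp ((c : ℂ) * I) * (exp (((-m : ℝ) : ℂ) * I) * w) - 1))) / π < 1 / 2 := by
        rw [div_lt_iff₀ hπ]; linarith [harg.2]
      linarith
  · -- boundary value `1` on the arc
    intro θ h1 h2
    have hφ1 : -c < θ - m := by rw [hc, hm]; linarith
    have hφ2 : θ - m < c := by rw [hc, hm]; linarith
    obtain ⟨hden, hre0, him⟩ := N_boundary c m θ (by linarith) (by linarith)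
    have hcos := cos_sub_cos_neg c (-m + θ) hcπ (by linarith) (by linarith)
    have him0 : 0 < (-I * ((exp (((-m : ℝ) : ℂ) * I) * exp ((θ : ℂ) * I) - exp ((c : ℂ) * I)) /
        (exp ((c : ℂ) * I) * (exp (((-m : ℝ) : ℂ) * I) * exp ((θ : ℂ) * I)) - 1))).im := by
      rw [him, neg_div, neg_pos]
      exact div_neg_of_neg_of_pos (by linarith) (normSq_pos.mpr hden)
    have key := tendsto_F_re _ _ _ (ball (0 : ℂ) 1) hden
      (mem_slitPlane_iff.mpr (Or.inr him0.ne'))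
    rw [re_formula, arg_eq_pi_div_two_iff.mpr ⟨hre0, him0⟩] at key
    have hval : π / 2 / π + 1 / 2 = (1 : ℝ) := by
      field_simp
      ring
    rw [hval] at key
    exact key
  · -- boundary value `0` on the complementary arc
    intro θ h1 h2
    have hφ1 : c < θ - m := by rw [hc, hm]; linarith
    have hφ2 : θ - m < 2 * π - c := by rw [hc, hm]; linarith
    obtain ⟨hden, hre0, him⟩ := N_boundary c m θ (by linarith) (by linarith)
    have hcos := cos_sub_cos_pos c (-m + θ) hc0 (by linarith) (by linarith)
    have him0 : (-I * ((exp (((-m : ℝ) : ℂ) * I) * exp ((θ : ℂ) * I) - exp ((c : ℂ) * I)) /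
        (exp ((c : ℂ) * I) * (exp (((-m : ℝ) : ℂ) * I) * exp ((θ : ℂ) * I)) - 1))).im < 0 := by
      rw [him, neg_div, neg_lt_zero]
      exact div_pos (by linarith) (normSq_pos.mpr hden)
    have key := tendsto_F_re _ _ _ (ball (0 : ℂ) 1) hden
      (mem_slitPlane_iff.mpr (Or.inr him0.ne))
    rw [re_formula, arg_eq_neg_pi_div_two_iff.mpr ⟨hre0, him0⟩] at key
    have hval : -(π / 2) / π + 1 / 2 = (0 : ℝ) := by
      field_simp
      ring
    rw [hval] at key
    exact key

end Summit.CriticalPhenomena.CardyFormulaZ2.Theorems.CardyQContinuation
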